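import Mathlib
import HarnessLib
import Summits.HubbardSuperconductivity.HubbardSuperconductivity.Theorems.KLProgrammeKLRegimeSplitSymInterpBounds

/-!
# Route `KLProgramme`, crux K3 (stmt-HubbardSuperconductivity-19937) — the `symInterp` TOOLKIT, part 4: VOLUME-UNIFORM lattice sums of the
# position-space weights, `Σ_x (1+|x̃₀|+|x̃₁|)·|f_c(x)| ≤ 16·B` from the mixed decay `(1+|x̃₀|)³(1+|x̃₁|)³·|f_c(x)| ≤ B`

Cell gate-hubbard-kl, seat p1b (g4).  Closes the arithmetic left «to the consumer» in parts 1–3: `coeffNorm 1 (symInterp L f) ≤ Σ_x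
(1+|x̃₀|+|x̃₁|)|f_c(x)|` (`coeffNorm_symInterp_le`) is bounded UNIFORMLY IN `L` by `16·B` as soon as the cosine coefficients decay like
`B/((1+|x̃₀|)³(1+|x̃₁|)³)` (which `abs_torusCosCoeff_mul_pow_le_of_sup` gives from third differences in each direction, or an isotropic
`(1+|x̃|)⁶` decay gives a fortiori).  Tools: the fibres of `u ↦ |ũ|` on `ZMod L` have at most two points (`card_filter_natAbs_valMinAbs_le_two`),
`Σ_{n ≤ N} 1/(1+n)² ≤ 2`, hence `Σ_{u : ZMod L} 1/(1+|ũ|)² ≤ 4` and the product structure of `(ZMod L)²`.  Proofs only.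
-/

noncomputable section

namespace Summit.HubbardSuperconductivity.HubbardSuperconductivity.Theorems.KLRegimeSplit

set_option linter.dupNamespace false -- summit = problem name (single-conjunct summit), D-0017

open Real Finset Literature.MathematicalPhysics.QuantumLattice Literature.Probability.LatticeModels

/-! ## §1 One-dimensional sums over `ZMod L` -/

/-- `Σ_{n ≤ N} 1/(1+n)² ≤ 2 − 1/(N+1)` (telescoping against `1/(n(n+1))`). -/
theorem sum_inv_one_add_sq_le (N : ℕ) : ∑ n ∈ range (N + 1), (1 : ℝ) / (1 + (n : ℝ)) ^ 2 ≤ 2 - 1 / ((N : ℝ) + 1) := by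
  induction N with
  | zero => norm_num
  | succ N ih =>
    rw [sum_range_succ]
    have hN : (0 : ℝ) < (N : ℝ) + 1 := by positivity
    have hstep : (1 : ℝ) / (1 + ((N + 1 : ℕ) : ℝ)) ^ 2 ≤ 1 / ((N : ℝ) + 1) - 1 / ((N : ℝ) + 1 + 1) := by
      push_cast
      rw [div_sub_div _ _ hN.ne' (by positivity), div_le_div_iff₀ (by positivity) (by positivity)]
      ring_nf
      nlinarith
    push_cast at hstep ⊢
    linarith

/-- `Σ_{n ≤ N} 1/(1+n)² ≤ 2`. -/
theorem sum_inv_one_add_sq_le_two (N : ℕ) : ∑ n ∈ range (N + 1), (1 : ℝ) / (1 + (n : ℝ)) ^ 2 ≤ 2 := by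
  have h := sum_inv_one_add_sq_le N
  have hpos : (0 : ℝ) < 1 / ((N : ℝ) + 1) := by positivity
  linarith

variable (L : ℕ) [NeZero L]

/-- **The fibres of `u ↦ |ũ|` on `ZMod L` have at most two points** (`valMinAbs` is injective and `|z| = n ⇔ z = ±n`). -/
theorem card_filter_natAbs_valMinAbs_le_two (n : ℕ) :
    (univ.filter fun u : ZMod L => u.valMinAbs.natAbs = n).card ≤ 2 := by
  classical
  have hmaps : ∀ u ∈ univ.filter (fun u : ZMod L => u.valMinAbs.natAbs = n), u.valMinAbs ∈ ({(n : ℤ), -(n : ℤ)} : Finset ℤ) := by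
    intro u hu
    rw [mem_filter] at hu
    rcases Int.natAbs_eq_iff.1 hu.2 with h | h
    · simp [h]
    · simp [h]
  have hinj : Set.InjOn (fun u : ZMod L => u.valMinAbs) (univ.filter fun u : ZMod L => u.valMinAbs.natAbs = n) :=
    fun a _ b _ hab => (ZMod.valMinAbs_inj (a := a) (b := b)).1 hab
  refine (card_le_card_of_injOn _ hmaps hinj).trans ?_
  exact (card_insert_le _ _).trans (by simp)

/-- **`Σ_{u : ZMod L} 1/(1+|ũ|)² ≤ 4`**, uniformly in `L`. -/
theorem sum_inv_one_add_natAbs_sq_le_four :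
    ∑ u : ZMod L, (1 : ℝ) / (1 + ((u.valMinAbs.natAbs : ℕ) : ℝ)) ^ 2 ≤ 4 := by
  classical
  set a : ZMod L → ℕ := fun u => u.valMinAbs.natAbs with ha
  have hmaps : ∀ u ∈ (univ : Finset (ZMod L)), a u ∈ range (L + 1) := fun u _ =>
    mem_range.2 (Nat.lt_succ_of_le ((ZMod.natAbs_valMinAbs_le u).trans (Nat.div_le_self L 2)))
  rw [← sum_fiberwise_of_maps_to hmaps]
  have hfib : ∀ n ∈ range (L + 1), ∑ u ∈ univ.filter (fun u : ZMod L => a u = n), (1 : ℝ) / (1 + ((a u : ℕ) : ℝ)) ^ 2 ≤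
      2 * ((1 : ℝ) / (1 + (n : ℝ)) ^ 2) := by
    intro n _
    have hconst : ∑ u ∈ univ.filter (fun u : ZMod L => a u = n), (1 : ℝ) / (1 + ((a u : ℕ) : ℝ)) ^ 2 =
        ∑ _u ∈ univ.filter (fun u : ZMod L => a u = n), (1 : ℝ) / (1 + (n : ℝ)) ^ 2 :=
      sum_congr rfl fun u hu => by rw [(mem_filter.1 hu).2]
    rw [hconst, sum_const, nsmul_eq_mul]
    have hcard : ((univ.filter (fun u : ZMod L => a u = n)).card : ℝ) ≤ 2 := by
      exact_mod_cast card_filter_natAbs_valMinAbs_le_two L n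
    exact mul_le_mul_of_nonneg_right hcard (by positivity)
  calc ∑ n ∈ range (L + 1), ∑ u ∈ univ.filter (fun u : ZMod L => a u = n), (1 : ℝ) / (1 + ((a u : ℕ) : ℝ)) ^ 2
      ≤ ∑ n ∈ range (L + 1), 2 * ((1 : ℝ) / (1 + (n : ℝ)) ^ 2) := sum_le_sum hfib
    _ = 2 * ∑ n ∈ range (L + 1), (1 : ℝ) / (1 + (n : ℝ)) ^ 2 := by rw [mul_sum]
    _ ≤ 2 * 2 := mul_le_mul_of_nonneg_left (sum_inv_one_add_sq_le_two L) (by norm_num)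
    _ = 4 := by norm_num

/-! ## §2 The two-dimensional weighted sum -/

/-- Product structure: `Σ_{x : (ZMod L)²} h(x₀)·h(x₁) = (Σ_u h u)²`. -/
theorem sum_torusSite_mul (h : ZMod L → ℝ) : ∑ x : TorusSite 2 L, h (x 0) * h (x 1) = (∑ u : ZMod L, h u) ^ 2 := by
  have hprod : ∀ x : TorusSite 2 L, h (x 0) * h (x 1) = ∏ i : Fin 2, h (x i) := fun x => by rw [Fin.prod_univ_two]
  simp_rw [hprod]
  rw [← Fintype.piFinset_univ, ← Finset.prod_univ_sum (fun _ : Fin 2 => (univ : Finset (ZMod L))) (fun _ a => h a),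
    Fin.prod_univ_two, sq]

/-- **VOLUME-UNIFORM WEIGHTED SUM OF THE COSINE COEFFICIENTS**: if `(1+|x̃₀|)³·(1+|x̃₁|)³·|f_c(x)| ≤ B` at every site, then
`Σ_x (1+|x̃₀|+|x̃₁|)·|f_c(x)| ≤ 16·B`. -/
theorem sum_weight_abs_torusCosCoeff_le (f : TorusSite 2 L → ℝ) {B : ℝ}
    (hB : ∀ x : TorusSite 2 L,
      (1 + ((x 0).valMinAbs.natAbs : ℝ)) ^ 3 * (1 + ((x 1).valMinAbs.natAbs : ℝ)) ^ 3 * |torusCosCoeff L f x| ≤ B) :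
    ∑ x : TorusSite 2 L, (1 + (x 0).valMinAbs.natAbs + (x 1).valMinAbs.natAbs : ℝ) * |torusCosCoeff L f x| ≤ 16 * B := by
  have hB0 : 0 ≤ B := by
    have h := hB 0
    exact le_trans (by positivity) h
  set h : ZMod L → ℝ := fun u => (1 : ℝ) / (1 + ((u.valMinAbs.natAbs : ℕ) : ℝ)) ^ 2 with hh
  have hterm : ∀ x : TorusSite 2 L, (1 + (x 0).valMinAbs.natAbs + (x 1).valMinAbs.natAbs : ℝ) * |torusCosCoeff L f x| ≤
      B * (h (x 0) * h (x 1)) := by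
    intro x
    set a0 : ℝ := ((x 0).valMinAbs.natAbs : ℝ) with ha0
    set a1 : ℝ := ((x 1).valMinAbs.natAbs : ℝ) with ha1
    have h0 : 0 ≤ a0 := Nat.cast_nonneg _
    have h1 : 0 ≤ a1 := Nat.cast_nonneg _
    have hc : 0 ≤ |torusCosCoeff L f x| := abs_nonneg _
    have hx := hB x
    have hpos : 0 < (1 + a0) ^ 2 * (1 + a1) ^ 2 := by positivity
    -- (1 + a0 + a1) ≤ (1+a0)(1+a1) and |f_c| ≤ B / ((1+a0)³(1+a1)³)
    have hw : (1 + a0 + a1) * |torusCosCoeff L f x| ≤ (1 + a0) * (1 + a1) * |torusCosCoeff L f x| :=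
      mul_le_mul_of_nonneg_right (by nlinarith) hc
    have hkey : (1 + a0) * (1 + a1) * |torusCosCoeff L f x| * ((1 + a0) ^ 2 * (1 + a1) ^ 2) ≤ B := by
      have e : (1 + a0) * (1 + a1) * |torusCosCoeff L f x| * ((1 + a0) ^ 2 * (1 + a1) ^ 2) =
          (1 + a0) ^ 3 * (1 + a1) ^ 3 * |torusCosCoeff L f x| := by ring
      rw [e]; exact hx
    have hdiv : (1 + a0) * (1 + a1) * |torusCosCoeff L f x| ≤ B / ((1 + a0) ^ 2 * (1 + a1) ^ 2) := by
      rw [le_div_iff₀ hpos]; exact hkey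
    have hh' : h (x 0) * h (x 1) = 1 / ((1 + a0) ^ 2 * (1 + a1) ^ 2) := by
      simp only [hh, ha0, ha1]; rw [one_div_mul_one_div]
    rw [hh']
    calc (1 + a0 + a1) * |torusCosCoeff L f x| ≤ (1 + a0) * (1 + a1) * |torusCosCoeff L f x| := hw
      _ ≤ B / ((1 + a0) ^ 2 * (1 + a1) ^ 2) := hdiv
      _ = B * (1 / ((1 + a0) ^ 2 * (1 + a1) ^ 2)) := by ring
  calc ∑ x : TorusSite 2 L, (1 + (x 0).valMinAbs.natAbs + (x 1).valMinAbs.natAbs : ℝ) * |torusCosCoeff L f x|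
      ≤ ∑ x : TorusSite 2 L, B * (h (x 0) * h (x 1)) := sum_le_sum fun x _ => hterm x
    _ = B * (∑ u : ZMod L, h u) ^ 2 := by rw [← mul_sum, sum_torusSite_mul]
    _ ≤ B * 4 ^ 2 := by
        refine mul_le_mul_of_nonneg_left ?_ hB0
        have h4 := sum_inv_one_add_natAbs_sq_le_four L
        have h0 : 0 ≤ ∑ u : ZMod L, h u := sum_nonneg fun u _ => by positivity
        exact pow_le_pow_left₀ h0 h4 2
    _ = 16 * B := by ring

/-- **Corollary for the interpolant's first weight**: under the same decay, `coeffNorm 1 (symInterp L f) ≤ 16·B` uniformly in `L`. -/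
theorem coeffNorm_one_symInterp_le_of_decay (f : TorusSite 2 L → ℝ) {B : ℝ}
    (hB : ∀ x : TorusSite 2 L,
      (1 + ((x 0).valMinAbs.natAbs : ℝ)) ^ 3 * (1 + ((x 1).valMinAbs.natAbs : ℝ)) ^ 3 * |torusCosCoeff L f x| ≤ B) :
    (symInterp L f).coeffNorm 1 ≤ 16 * B := by
  refine (coeffNorm_symInterp_le f 1).trans ?_
  simp only [pow_one]
  exact sum_weight_abs_torusCosCoeff_le L f hB

end Summit.HubbardSuperconductivity.HubbardSuperconductivity.Theorems.KLRegimeSplit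

end
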